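import Mathlib
import Summits.NavierStokesRegularity.NavierStokesRegularity.Theorems.FilamentSkeletonRssAnalyticStripLiaSymbolNumericsSound
import Summits.NavierStokesRegularity.NavierStokesRegularity.Theorems.FilamentSkeletonRssClause13LiaSymbolDeriv

/-!
# The SHARP Laplace bound `C(p) ≤ (1 + 2√p)·e^{−2√p}`, i.e. `x·K₁(x) ≤ (1 + x)·e^{−x}`
# (`TangentSkeletonNearStraightL`, stmt-NavierStokesRegularity-23320; constant of the swirl-band decoupling (R♯-sw))

For the tree's `Numerics.Cint p = ∫₀^∞ e^{−t}e^{−p/t} dt` (`= 2√p·K₁(2√p)`) the landed bound is `Cint p ≤ 2e^{−√p}`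
(`…Clause13SymbolDecay.Cint_le_exp`), which loses half the exponent.  The strategist's typed statement (R♯-sw)
`SwirlBandDecouplingL` asks for the sharp form `(1 + kD)e^{−kD}`, i.e. `x·K₁(x) ≤ (1+x)e^{−x}` — equality at `x = 0`, correct
order `√(πx/2)e^{−x}` at infinity.  Proof (elementary, def-free):

* `exp_mul_Cint_sq_eq_integral` : `e^{2s}·C(s²) = ∫_ℝ e^{−u²}(u²+2s)/√(u²+4s) du` for `s > 0` — the substitution
  `u = √t − s/√t` (`t + s²/t = u² + 2s`; one-dimensional change of variables `integral_image_eq_integral_abs_deriv_smul`;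
  the even Jacobian weight is `(t²+s²)/(2t²)` and `∫₀^∞ e^{−t−s²/t}s²/t² dt = C(s²)` is the tree's `integral_E2_eq`);
* `integral_Ioi_defect` : the defect `ρ(u) = (u²+2s)/√(u²+4s) − u ≥ 0` has `∫₀^∞ ρ = s` (primitive `(u√(u²+4s) − u²)/2 → s`);
* `Cint_le_sharp` : hence `e^{2s}C(s²) = 2∫₀^∞ e^{−u²}(u + ρ) ≤ 2(½ + s)`.

HONEST FRAMING: an inequality about one explicit real integral, serving the LINEAR THEORY of a HYPOTHETICAL filament skeleton
on the NEGATIVE side of a MODEL route; it proves no registered stub, and nothing here bears on Navier–Stokes regularity or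
blow-up.  `--supports stmt-NavierStokesRegularity-23320`.
-/

set_option linter.dupNamespace false

noncomputable section

open Real Set MeasureTheory Filter Topology

namespace Summit.NavierStokesRegularity.NavierStokesRegularity.Theorems.TangentSkeletonNearStraightLSwirlBand

open Summit.NavierStokesRegularity.NavierStokesRegularity.Theorems.AnalyticStripLiaSymbol
open Summit.NavierStokesRegularity.NavierStokesRegularity.Theorems.AnalyticStripLiaSymbol.Numerics

/-! ## §3  The sharp Laplace bound `C(p) ≤ (1 + 2√p)·e^{−2√p}` (i.e. `x·K₁(x) ≤ (1+x)e^{−x}`) -/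

/-- `C(0) = 1`. [folklore] -/
theorem Cint_zero : Cint 0 = 1 := by
  unfold Cint
  have : ∀ t ∈ Ioi (0:ℝ), Real.exp (-t) * Real.exp (-(0 / t)) = Real.exp (-t) := by
    intro t _; simp
  rw [setIntegral_congr_fun measurableSet_Ioi this, integral_exp_neg_Ioi_zero]

/-- `C(p) ≥ 0`. [folklore] -/
theorem Cint_nonneg (p : ℝ) : 0 ≤ Cint p := by
  unfold Cint
  exact setIntegral_nonneg measurableSet_Ioi fun t _ => by positivity

/-- `∫₀^∞ u·e^{−u²} du = 1/2`. [folklore] -/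
theorem integral_Ioi_mul_exp_neg_sq : ∫ u in Ioi (0:ℝ), u * Real.exp (-u ^ 2) = 1 / 2 := by
  have hderiv : ∀ u ∈ Ioi (0:ℝ), HasDerivAt (fun u : ℝ => -Real.exp (-u ^ 2) / 2) (u * Real.exp (-u ^ 2)) u := by
    intro u _
    have h0 : HasDerivAt (fun u : ℝ => u ^ 2) (2 * u) u := by simpa using hasDerivAt_pow 2 u
    have h1 : HasDerivAt (fun u : ℝ => -u ^ 2) (-(2 * u)) u := h0.neg
    have h2 := h1.exp
    refine ((h2.neg).div_const 2).congr_deriv ?_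
    ring
  have hcont : ContinuousWithinAt (fun u : ℝ => -Real.exp (-u ^ 2) / 2) (Ici 0) 0 :=
    (by fun_prop : Continuous (fun u : ℝ => -Real.exp (-u ^ 2) / 2)).continuousWithinAt
  have hlim : Tendsto (fun u : ℝ => -Real.exp (-u ^ 2) / 2) atTop (𝓝 (-0 / 2)) := by
    refine ((Real.tendsto_exp_atBot.comp ?_).neg).div_const 2
    have : Tendsto (fun u : ℝ => u ^ 2) atTop atTop := tendsto_pow_atTop (by norm_num)
    exact tendsto_neg_atTop_atBot.comp this
  have := integral_Ioi_of_hasDerivAt_of_nonneg hcont hderiv (fun u (_ : 0 < u) => by positivity) hlim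
  rw [this]; norm_num

/-- The defect `ρ(u) = (u²+2s)/√(u²+4s) − u` of the even Jacobian weight is nonnegative (`u ≥ 0`, `s ≥ 0`). [folklore] -/
theorem weight_ge {s u : ℝ} (hs : 0 ≤ s) (hsu : 0 < u ^ 2 + 4 * s) :
    u ≤ (u ^ 2 + 2 * s) / √(u ^ 2 + 4 * s) := by
  have hq : 0 < √(u ^ 2 + 4 * s) := Real.sqrt_pos.mpr hsu
  rw [le_div_iff₀ hq]
  have hsq : √(u ^ 2 + 4 * s) ^ 2 = u ^ 2 + 4 * s := Real.sq_sqrt hsu.le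
  rcases le_or_gt u 0 with hu | hu
  · have : u * √(u ^ 2 + 4 * s) ≤ 0 := mul_nonpos_iff.mpr (Or.inr ⟨hu, hq.le⟩)
    nlinarith [this]
  · -- `(u q)² = u²(u²+4s) ≤ (u²+2s)²`, both sides nonnegative
    have hY : 0 < u ^ 2 + 2 * s := by positivity
    have hX : 0 ≤ u * √(u ^ 2 + 4 * s) := by positivity
    nlinarith [hsq, hY, hX, sq_nonneg (u ^ 2 + 2 * s - u * √(u ^ 2 + 4 * s))]

/-- The antiderivative `R(u) = (u·√(u²+4s) − u²)/2` of the defect tends to `s` at `+∞`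
(`0 ≤ s − R(u) ≤ s²/u²`). [folklore] -/
theorem tendsto_defect_primitive {s : ℝ} (hs : 0 < s) :
    Tendsto (fun u : ℝ => (u * √(u ^ 2 + 4 * s) - u ^ 2) / 2) atTop (𝓝 s) := by
  -- squeeze between `s - s²/u²` and `s`
  have hup : ∀ᶠ u : ℝ in atTop, (u * √(u ^ 2 + 4 * s) - u ^ 2) / 2 ≤ s := by
    filter_upwards [eventually_gt_atTop (0:ℝ)] with u hu
    have hq0 : 0 ≤ u ^ 2 + 4 * s := by positivity
    have hsq : √(u ^ 2 + 4 * s) ^ 2 = u ^ 2 + 4 * s := Real.sq_sqrt hq0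
    -- `u√(u²+4s) ≤ u² + 2s` since `(u²+2s)² - u²(u²+4s) = 4s² ≥ 0`
    nlinarith [sq_nonneg (√(u ^ 2 + 4 * s) - (u + 2 * s / u)), Real.sqrt_nonneg (u ^ 2 + 4 * s),
      sq_nonneg (u * √(u ^ 2 + 4 * s) - (u ^ 2 + 2 * s)), mul_pos hu (Real.sqrt_pos.mpr (by positivity : 0 < u ^ 2 + 4 * s))]
  have hlow : ∀ᶠ u : ℝ in atTop, s - s ^ 2 / u ^ 2 ≤ (u * √(u ^ 2 + 4 * s) - u ^ 2) / 2 := by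
    filter_upwards [eventually_gt_atTop (0:ℝ)] with u hu
    have hq0 : 0 < u ^ 2 + 4 * s := by positivity
    have hsq : √(u ^ 2 + 4 * s) ^ 2 = u ^ 2 + 4 * s := Real.sq_sqrt hq0.le
    have hge : u ≤ √(u ^ 2 + 4 * s) := by
      have := Real.sqrt_le_sqrt (show u ^ 2 ≤ u ^ 2 + 4 * s by linarith)
      rwa [Real.sqrt_sq hu.le] at this
    generalize √(u ^ 2 + 4 * s) = q at hsq hge ⊢
    have hqu : 0 < q + u := by linarith
    have hu2 : 0 < u ^ 2 := by positivity
    -- clear denominators: `s - s²/u² ≤ (uq - u²)/2` ⟸ `2u²s - 2s² ≤ (uq - u²)u²`... via `4s = q² - u²`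
    rw [sub_le_iff_le_add, show (u * q - u ^ 2) / 2 + s ^ 2 / u ^ 2 = ((u * q - u ^ 2) * u ^ 2 + 2 * s ^ 2) / (2 * u ^ 2) by
      field_simp]
    rw [le_div_iff₀ (by positivity)]
    have hs4 : s = (q ^ 2 - u ^ 2) / 4 := by linarith
    subst hs4
    nlinarith [mul_nonneg (mul_nonneg (pow_nonneg (sub_nonneg.mpr hge) 3) hqu.le) (show 0 ≤ q + 3 * u by linarith),
      hge, hu]
  have hlim : Tendsto (fun u : ℝ => s - s ^ 2 / u ^ 2) atTop (𝓝 s) := by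
    have : Tendsto (fun u : ℝ => s ^ 2 / u ^ 2) atTop (𝓝 0) := by
      have h := (tendsto_pow_atTop (n := 2) (by norm_num : (2:ℕ) ≠ 0) (α := ℝ)).inv_tendsto_atTop
      simpa [div_eq_mul_inv] using h.const_mul (s ^ 2)
    simpa using (tendsto_const_nhds (x := s)).sub this
  exact tendsto_of_tendsto_of_tendsto_of_le_of_le' hlim tendsto_const_nhds hlow hup


/-- The substitution `φ(t) = √t − s/√t` has derivative `(t+s)/(2t√t)` at every `t > 0`. [folklore] -/
theorem hasDerivAt_subst (s : ℝ) {t : ℝ} (ht : 0 < t) :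
    HasDerivAt (fun t : ℝ => √t - s / √t) ((t + s) / (2 * t * √t)) t := by
  have hst : 0 < √t := Real.sqrt_pos.mpr ht
  have h1 : HasDerivAt (fun t : ℝ => √t) (1 / (2 * √t)) t := Real.hasDerivAt_sqrt ht.ne'
  have h2 : HasDerivAt (fun y : ℝ => s / √y) ((0 * √t - s * (1 / (2 * √t))) / √t ^ 2) t :=
    (hasDerivAt_const t s).fun_div h1 hst.ne'
  refine (h1.fun_sub h2).congr_deriv ?_
  obtain ⟨r, hr, rfl⟩ : ∃ r : ℝ, 0 < r ∧ r ^ 2 = t := ⟨√t, hst, Real.sq_sqrt ht.le⟩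
  rw [Real.sqrt_sq hr.le]
  field_simp
  ring

/-- `φ(t) = √t − s/√t` is strictly increasing on `(0, ∞)` for `s ≥ 0`. [folklore] -/
theorem subst_strictMonoOn {s : ℝ} (hs : 0 ≤ s) : StrictMonoOn (fun t : ℝ => √t - s / √t) (Ioi 0) := by
  intro a ha b _ hab
  have ha' : 0 < √a := Real.sqrt_pos.mpr ha
  have hab' : √a < √b := Real.sqrt_lt_sqrt (le_of_lt ha) hab
  have : s / √b ≤ s / √a := div_le_div_of_nonneg_left hs ha' hab'.le
  show √a - s / √a < √b - s / √b
  linarith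

/-- `φ(t) = √t − s/√t` maps `(0, ∞)` ONTO `ℝ` for `s > 0` (`φ(w²) = u` for `w = (u + √(u²+4s))/2`). [folklore] -/
theorem subst_image {s : ℝ} (hs : 0 < s) : (fun t : ℝ => √t - s / √t) '' Ioi 0 = univ := by
  refine eq_univ_of_forall fun u => ?_
  have hsq : √(u ^ 2 + 4 * s) ^ 2 = u ^ 2 + 4 * s := Real.sq_sqrt (by positivity)
  have hq : |u| < √(u ^ 2 + 4 * s) := by
    rw [← Real.sqrt_sq_eq_abs]; exact Real.sqrt_lt_sqrt (sq_nonneg u) (by linarith)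
  have hw0 : 0 < (u + √(u ^ 2 + 4 * s)) / 2 := by linarith [neg_abs_le u]
  refine ⟨((u + √(u ^ 2 + 4 * s)) / 2) ^ 2, pow_pos hw0 2, ?_⟩
  show √(((u + √(u ^ 2 + 4 * s)) / 2) ^ 2) - s / √(((u + √(u ^ 2 + 4 * s)) / 2) ^ 2) = u
  rw [Real.sqrt_sq hw0.le]
  have : s / ((u + √(u ^ 2 + 4 * s)) / 2) = (√(u ^ 2 + 4 * s) - u) / 2 := by
    rw [div_eq_iff hw0.ne']
    linear_combination (-1 / 4 : ℝ) * hsq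
  rw [this]; ring

/-- **The Jacobian identity**: for `s > 0`,
`e^{2s}·C(s²) = ∫_ℝ e^{−u²}·(u²+2s)/√(u²+4s) du` — substitute `u = √t − s/√t` in `C(s²) = ∫₀^∞ e^{−t−s²/t}dt`
(`t + s²/t = u² + 2s`; the even Jacobian weight is `(t²+s²)/(2t²)`, and `∫ e^{−t−s²/t} s²/t² = C(s²)` by `t ↦ s²/t`,
the tree's `integral_E2_eq`). [folklore] -/
theorem exp_mul_Cint_sq_eq_integral {s : ℝ} (hs : 0 < s) :
    Real.exp (2 * s) * Cint (s ^ 2)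
      = ∫ u : ℝ, Real.exp (-u ^ 2) * ((u ^ 2 + 2 * s) / √(u ^ 2 + 4 * s)) := by
  have himg := integral_image_eq_integral_abs_deriv_smul (s := Ioi (0:ℝ))
    (f := fun t : ℝ => √t - s / √t) (f' := fun t => (t + s) / (2 * t * √t)) measurableSet_Ioi
    (fun t ht => (hasDerivAt_subst s ht).hasDerivWithinAt) (subst_strictMonoOn hs.le).injOn
    (fun u : ℝ => Real.exp (-u ^ 2) * ((u ^ 2 + 2 * s) / √(u ^ 2 + 4 * s)))
  rw [subst_image hs, Measure.restrict_univ] at himg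
  rw [himg]
  have hpt : ∀ t ∈ Ioi (0:ℝ), |(t + s) / (2 * t * √t)| • (Real.exp (-(√t - s / √t) ^ 2)
      * (((√t - s / √t) ^ 2 + 2 * s) / √((√t - s / √t) ^ 2 + 4 * s)))
        = Real.exp (2 * s) * (1 / 2) * (Real.exp (-t) * Real.exp (-(s ^ 2 / t))
          + s ^ 2 * (Real.exp (-t) * Real.exp (-(s ^ 2 / t)) / t ^ 2)) := by
    intro t ht
    have ht : (0:ℝ) < t := ht
    obtain ⟨r, hr, rfl⟩ : ∃ r : ℝ, 0 < r ∧ r ^ 2 = t := ⟨√t, Real.sqrt_pos.mpr ht, Real.sq_sqrt ht.le⟩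
    rw [Real.sqrt_sq hr.le]
    have hr0 : r ≠ 0 := hr.ne'
    have e1 : (r - s / r) ^ 2 + 4 * s = (r + s / r) ^ 2 := by field_simp; ring
    have e2 : 0 ≤ r + s / r := by positivity
    rw [e1, Real.sqrt_sq e2]
    have e3 : -(r - s / r) ^ 2 = 2 * s + (-(r ^ 2) + -(s ^ 2 / r ^ 2)) := by field_simp; ring
    rw [e3, Real.exp_add, Real.exp_add]
    have e4 : |(r ^ 2 + s) / (2 * r ^ 2 * r)| = (r ^ 2 + s) / (2 * r ^ 2 * r) := abs_of_pos (by positivity)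
    rw [e4, smul_eq_mul]
    field_simp
    ring
  rw [setIntegral_congr_fun measurableSet_Ioi hpt, integral_const_mul,
    integral_add (integrableOn_fC (sq_nonneg s)) ((integrableOn_E2_integrand (pow_pos hs 2)).const_mul (s ^ 2)),
    integral_const_mul, integral_E2_eq (pow_pos hs 2)]
  rw [show (∫ t in Ioi (0:ℝ), Real.exp (-t) * Real.exp (-(s ^ 2 / t))) = Cint (s ^ 2) from rfl]
  have : s ^ 2 ≠ 0 := by positivity
  field_simp
  ring

/-- The defect `ρ(u) = (u²+2s)/√(u²+4s) − u` integrates to `s` over `(0, ∞)` (primitive `(u√(u²+4s) − u²)/2 → s`). [folklore] -/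
theorem integral_Ioi_defect {s : ℝ} (hs : 0 < s) :
    ∫ u in Ioi (0:ℝ), ((u ^ 2 + 2 * s) / √(u ^ 2 + 4 * s) - u) = s
    ∧ IntegrableOn (fun u : ℝ => (u ^ 2 + 2 * s) / √(u ^ 2 + 4 * s) - u) (Ioi 0) := by
  have hcont : ContinuousWithinAt (fun u : ℝ => (u * √(u ^ 2 + 4 * s) - u ^ 2) / 2) (Ici 0) 0 :=
    (by fun_prop : Continuous (fun u : ℝ => (u * √(u ^ 2 + 4 * s) - u ^ 2) / 2)).continuousWithinAt
  have hderiv : ∀ u ∈ Ioi (0:ℝ), HasDerivAt (fun u : ℝ => (u * √(u ^ 2 + 4 * s) - u ^ 2) / 2)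
      ((u ^ 2 + 2 * s) / √(u ^ 2 + 4 * s) - u) u := by
    intro u _
    have hq0 : 0 < u ^ 2 + 4 * s := by positivity
    have hin : HasDerivAt (fun u : ℝ => u ^ 2 + 4 * s) (2 * u) u := by
      simpa using (hasDerivAt_pow 2 u).add_const (4 * s)
    have hsqrt := hin.sqrt hq0.ne'
    have hprod := (hasDerivAt_id' u).fun_mul hsqrt
    have hsq2 : HasDerivAt (fun u : ℝ => u ^ 2) (2 * u) u := by simpa using hasDerivAt_pow 2 u
    have hall := (hprod.fun_sub hsq2).div_const 2
    refine hall.congr_deriv ?_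
    have hsq : √(u ^ 2 + 4 * s) ^ 2 = u ^ 2 + 4 * s := Real.sq_sqrt hq0.le
    have hqpos : 0 < √(u ^ 2 + 4 * s) := Real.sqrt_pos.mpr hq0
    generalize √(u ^ 2 + 4 * s) = q at hsq hqpos ⊢
    field_simp
    linear_combination hsq
  have hpos : ∀ u ∈ Ioi (0:ℝ), 0 ≤ (u ^ 2 + 2 * s) / √(u ^ 2 + 4 * s) - u := fun u _ =>
    sub_nonneg.mpr (weight_ge hs.le (by positivity))
  have hlim := tendsto_defect_primitive hs
  refine ⟨?_, integrableOn_Ioi_deriv_of_nonneg hcont hderiv hpos hlim⟩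
  have := integral_Ioi_of_hasDerivAt_of_nonneg hcont hderiv hpos hlim
  rw [this]; simp

/-- **SHARP LAPLACE BOUND** `C(p) ≤ (1 + 2√p)·e^{−2√p}` for `p ≥ 0`, i.e. `x·K₁(x) ≤ (1+x)·e^{−x}` (`x = 2√p`);
equality at `p = 0`, and the right asymptotic order `√(πx/2)·e^{−x} ≤ (1+x)e^{−x}` at infinity.  Proof: by the Jacobian
identity, `e^{2s}C(s²) = 2∫₀^∞ e^{−u²}(u + ρ(u)) du ≤ 2(½ + ∫₀^∞ ρ) = 1 + 2s`. [folklore] -/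
theorem Cint_le_sharp {p : ℝ} (hp : 0 ≤ p) : Cint p ≤ (1 + 2 * √p) * Real.exp (-(2 * √p)) := by
  rcases hp.eq_or_lt with h0 | hp'
  · rw [← h0]; simp [Cint_zero]
  have hs : 0 < √p := Real.sqrt_pos.mpr hp'
  have hps : p = √p ^ 2 := (Real.sq_sqrt hp).symm
  generalize √p = s at hs hps
  subst hps
  -- the integrand `g` and its evenness
  have h2 : ∫ u : ℝ, Real.exp (-u ^ 2) * ((u ^ 2 + 2 * s) / √(u ^ 2 + 4 * s))
      = 2 * ∫ u in Ioi (0:ℝ), Real.exp (-u ^ 2) * ((u ^ 2 + 2 * s) / √(u ^ 2 + 4 * s)) := by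
    rw [← integral_comp_abs]
    congr 1; funext u; simp [sq_abs]
  -- the upper function on `(0,∞)`: `u e^{-u²} + ρ(u)`
  obtain ⟨hρ, hρi⟩ := integral_Ioi_defect hs
  have hgauss : IntegrableOn (fun u : ℝ => u * Real.exp (-u ^ 2)) (Ioi 0) := by
    have := (integrable_mul_exp_neg_mul_sq (b := 1) one_pos).integrableOn (s := Ioi 0)
    refine this.congr_fun (fun u _ => ?_) measurableSet_Ioi
    simp
  have hupper : ∫ u in Ioi (0:ℝ), Real.exp (-u ^ 2) * ((u ^ 2 + 2 * s) / √(u ^ 2 + 4 * s))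
      ≤ ∫ u in Ioi (0:ℝ), (u * Real.exp (-u ^ 2) + ((u ^ 2 + 2 * s) / √(u ^ 2 + 4 * s) - u)) := by
    refine integral_mono_of_nonneg ?_ (hgauss.add hρi) ?_
    · exact Filter.Eventually.of_forall fun u => by positivity
    · rw [EventuallyLE, ae_restrict_iff' measurableSet_Ioi]
      refine Filter.Eventually.of_forall fun u (hu : 0 < u) => ?_
      have hρ0 : 0 ≤ (u ^ 2 + 2 * s) / √(u ^ 2 + 4 * s) - u := sub_nonneg.mpr (weight_ge hs.le (by positivity))
      have hex : Real.exp (-u ^ 2) ≤ 1 := by rw [Real.exp_le_one_iff]; nlinarith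
      have hex0 : 0 ≤ Real.exp (-u ^ 2) := (Real.exp_pos _).le
      nlinarith [mul_le_mul_of_nonneg_right hex hρ0]
  rw [integral_add hgauss hρi, integral_Ioi_mul_exp_neg_sq, hρ] at hupper
  have hI := exp_mul_Cint_sq_eq_integral hs
  have hexp : 0 < Real.exp (-(2 * s)) := Real.exp_pos _
  calc Cint (s ^ 2) = Real.exp (-(2 * s)) * (Real.exp (2 * s) * Cint (s ^ 2)) := by
        rw [← mul_assoc, ← Real.exp_add]; simp
    _ ≤ Real.exp (-(2 * s)) * (1 + 2 * s) := by
        rw [hI, h2]; gcongr; linarith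
    _ = (1 + 2 * s) * Real.exp (-(2 * s)) := mul_comm _ _


end Summit.NavierStokesRegularity.NavierStokesRegularity.Theorems.TangentSkeletonNearStraightLSwirlBand
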